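import Summits.ABC.ABC.Theses.PadicPrimesW80TwoThirds
import Summits.ABC.ABC.Theorems.PadicPrimesW80TwoThirdsW80ThreeModFour
import Summits.ABC.ABC.Theorems.PadicPrimesW80TwoThirdsW80OneModFour
import Summits.ABC.ABC.Theorems.PadicPrimesW80TwoThirdsW80Two
import HarnessLib

/-!
# Rung A1.M2 by name: Stewart–Yu 1991 (`log c ≪_ε rad(abc)^{2/3+ε}`) — UNCONDITIONAL

`Summits/ABC/ABC/Theorems/StewartYu1991TwoThirdsHolds.lean` — cell `abc-stewartyu` (planner-staged template
HOME/plan/routes/closers/StewartYu1991TwoThirdsHolds.lean; filed by p3-g3 after the closer of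
stmt-ABC-19486).  The three cruxes of route `PadicPrimesW80TwoThirds` are landed theorems: `W80ThreeModFour`
(p2-g2, `padicPrimesW80TwoThirds_w80ThreeModFour_proof`: the twisted `p`-adic Waldschmidt descent at
`p ≡ 3 (mod 4)`), `W80OneModFour` (p3-g2's ± machine, `padicPrimesW80TwoThirds_w80OneModFour_proof`) and
`W80Two` (the `2`-adic `q = 3` descent, `padicPrimesW80TwoThirds_w80Two_proof`: lit g4 / p2-g3 / p1-g5 /
p4 / p3-g3); the route's `closes` (p3-g2's door `stewartYu1991_of_w80Shape`, the Stewart–Yu 1991 §3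
assembly on the Waldschmidt-1980 binder) composes them into the rung leaf
`Literature.Barriers.ABC.stewartYu1991_upperBound`.  [folklore] assembly.
-/

set_option linter.dupNamespace false

namespace Summit.ABC.ABC.Theorems

open Summit.ABC.ABC.Theses

/-- **Rung A1.M2 — the Stewart–Yu 1991 theorem holds**: for every `ε > 0` there are `κ, c₀` with
`log c ≤ κ · rad(abc)^{2/3+ε}` for all `abc`-triples with `c ≥ c₀` (the leaf
`Literature.Barriers.ABC.stewartYu1991_upperBound = EpsShapeBound (2/3)`), by the Waldschmidt-shape `p`-adic
bounds at every prime (the three residue texts) and the Stewart–Yu 1991 assembly. [cite: StewartYu1991,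
main theorem, as quoted in Waldschmidt2014 §2] -/
theorem stewartYu1991_holds : Literature.Barriers.ABC.stewartYu1991_upperBound :=
  PadicPrimesW80TwoThirds.closes padicPrimesW80TwoThirds_w80ThreeModFour_proof
    padicPrimesW80TwoThirds_w80OneModFour_proof padicPrimesW80TwoThirds_w80Two_proof

end Summit.ABC.ABC.Theorems
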